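import Summits.Ventures.PercRepro.ProfileFlatUpset

/-!
# PercRepro — THE FREE CASE OF (G): AN INTERSECTING UP-SET OF A POWER SET HAS AVERAGE SIZE MORE THAN HALF
(p10, gen 18; `proofs/P10-AVFULL.md` §26(c))

In the free matroid on a finite set `E` every subset is a flat, every partition is bi-independent, and the separated
family `sepSets` of an up-set `U` is `{Z ∈ U : E ∖ Z ∉ U}` — an INTERSECTING UP-SET of `2^E` (`IntersectingUpset`:
closed under supersets inside `E`, containing no set together with its complement).  THEOREM
(`sum_intersectingUpset_nonneg`): for every such family `S`, `Σ_{Z ∈ S} (2 #Z − #E − 1) ≥ 0` — the free case of the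
conjecture (G) (`FlatUpsetLimit`, ProfileFlatUpset).  Proof by induction on `E`: for `E = insert e E'`, the sets
avoiding `e` form an intersecting up-set `S₀` of `2^{E'}`, the sets containing `e` shifted by `e` form an up-set `S₁`
whose complementary pairs cancel in `Σ (2 #W − #E')`, leaving the complement-free part `T ⊇ S₀`, again an
intersecting up-set; the induction hypothesis on `S₀` and on `T` gives `Σ_S ≥ −#S₀ + #T ≥ 0`.  Nothing here asserts
(G) for general matroids.
-/

namespace PercRepro.Cogirth

open Finset

variable {α : Type} [DecidableEq α]

/-- An intersecting up-set of the power set of `E`: subsets of `E`, closed under supersets inside `E`, containing no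
set together with its complement. -/
structure IntersectingUpset (E : Finset α) (S : Finset (Finset α)) : Prop where
  sub : ∀ Z ∈ S, Z ⊆ E
  up : ∀ Z ∈ S, ∀ Z' : Finset α, Z ⊆ Z' → Z' ⊆ E → Z' ∈ S
  compl : ∀ Z ∈ S, E \ Z ∉ S

/-- Two members of an intersecting up-set intersect. -/
theorem IntersectingUpset.inter_nonempty {E : Finset α} {S : Finset (Finset α)} (h : IntersectingUpset E S)
    {Z W : Finset α} (hZ : Z ∈ S) (hW : W ∈ S) : (Z ∩ W).Nonempty := by
  by_contra hcon
  rw [not_nonempty_iff_eq_empty] at hcon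
  apply h.compl Z hZ
  apply h.up W hW _ _ sdiff_subset
  intro x hx
  rw [mem_sdiff]
  refine ⟨h.sub W hW hx, fun hxZ => ?_⟩
  have : x ∈ Z ∩ W := mem_inter.2 ⟨hxZ, hx⟩
  rw [hcon] at this
  exact notMem_empty x this

/-! ### The three derived families at an element `e` -/

/-- The members avoiding `e`. -/
def avoidFam (e : α) (S : Finset (Finset α)) : Finset (Finset α) := S.filter (fun Z => e ∉ Z)

/-- The members containing `e`, with `e` removed. -/
def shiftFam (e : α) (S : Finset (Finset α)) : Finset (Finset α) :=
  (S.filter (fun Z => e ∈ Z)).image (fun Z => Z.erase e)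

/-- The complement-free part of `shiftFam`, relative to `E'`. -/
def coreFam (E' : Finset α) (e : α) (S : Finset (Finset α)) : Finset (Finset α) :=
  (shiftFam e S).filter (fun W => E' \ W ∉ shiftFam e S)

/-- Membership in `avoidFam`. -/
theorem mem_avoidFam {e : α} {S : Finset (Finset α)} {Z : Finset α} :
    Z ∈ avoidFam e S ↔ Z ∈ S ∧ e ∉ Z := by
  unfold avoidFam
  rw [mem_filter]

/-- Membership in `shiftFam`: `W ∈ shiftFam e S ↔ e ∉ W ∧ insert e W ∈ S`. -/
theorem mem_shiftFam {e : α} {S : Finset (Finset α)} {W : Finset α} :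
    W ∈ shiftFam e S ↔ e ∉ W ∧ insert e W ∈ S := by
  unfold shiftFam
  rw [mem_image]
  constructor
  · rintro ⟨Z, hZ, rfl⟩
    rw [mem_filter] at hZ
    rw [insert_erase hZ.2]
    exact ⟨notMem_erase e Z, hZ.1⟩
  · rintro ⟨heW, hW⟩
    refine ⟨insert e W, ?_, erase_insert heW⟩
    rw [mem_filter]
    exact ⟨hW, mem_insert_self e W⟩

/-- Membership in `coreFam`. -/
theorem mem_coreFam {E' : Finset α} {e : α} {S : Finset (Finset α)} {W : Finset α} :
    W ∈ coreFam E' e S ↔ W ∈ shiftFam e S ∧ E' \ W ∉ shiftFam e S := by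
  unfold coreFam
  rw [mem_filter]

/-- The avoiding members form an intersecting up-set of `2^{E'}`. -/
theorem intersectingUpset_avoidFam {E' : Finset α} {e : α} (he : e ∉ E') {S : Finset (Finset α)}
    (h : IntersectingUpset (insert e E') S) : IntersectingUpset E' (avoidFam e S) where
  sub := by
    intro Z hZ
    rw [mem_avoidFam] at hZ
    intro x hx
    have hx' := h.sub Z hZ.1 hx
    rw [mem_insert] at hx'
    rcases hx' with rfl | hx'
    · exact absurd hx hZ.2
    · exact hx'
  up := by
    intro Z hZ Z' hZZ' hZ'
    rw [mem_avoidFam] at hZ ⊢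
    exact ⟨h.up Z hZ.1 Z' hZZ' (hZ'.trans (subset_insert e E')), fun hcon => he (hZ' hcon)⟩
  compl := by
    intro Z hZ hcon
    rw [mem_avoidFam] at hZ hcon
    apply h.compl Z hZ.1
    have hsub : E' \ Z ⊆ insert e E' \ Z := sdiff_subset_sdiff (subset_insert e E') (Subset.refl _)
    exact h.up _ hcon.1 _ hsub sdiff_subset

/-- The shifted members are subsets of `E'`. -/
theorem subset_of_mem_shiftFam {E' : Finset α} {e : α} {S : Finset (Finset α)}
    (h : IntersectingUpset (insert e E') S) {W : Finset α} (hW : W ∈ shiftFam e S) : W ⊆ E' := by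
  rw [mem_shiftFam] at hW
  intro x hx
  have hx' := h.sub _ hW.2 (mem_insert_of_mem hx)
  rw [mem_insert] at hx'
  rcases hx' with rfl | hx'
  · exact absurd hx hW.1
  · exact hx'

/-- The shifted family is an up-set of `2^{E'}`. -/
theorem shiftFam_up {E' : Finset α} {e : α} {S : Finset (Finset α)} (he : e ∉ E')
    (h : IntersectingUpset (insert e E') S) {W W' : Finset α} (hW : W ∈ shiftFam e S) (hWW' : W ⊆ W')
    (hW' : W' ⊆ E') : W' ∈ shiftFam e S := by
  rw [mem_shiftFam] at hW ⊢
  refine ⟨fun hcon => he (hW' hcon), ?_⟩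
  exact h.up _ hW.2 _ (insert_subset_insert e hWW') (insert_subset_insert e hW')

/-- The complement-free part of the shifted family is an intersecting up-set of `2^{E'}`. -/
theorem intersectingUpset_coreFam {E' : Finset α} {e : α} (he : e ∉ E') {S : Finset (Finset α)}
    (h : IntersectingUpset (insert e E') S) : IntersectingUpset E' (coreFam E' e S) where
  sub := fun W hW => subset_of_mem_shiftFam h (mem_coreFam.1 hW).1
  up := by
    intro W hW W' hWW' hW'
    rw [mem_coreFam] at hW ⊢
    refine ⟨shiftFam_up he h hW.1 hWW' hW', fun hcon => hW.2 ?_⟩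
    exact shiftFam_up he h hcon (sdiff_subset_sdiff (Subset.refl _) hWW') sdiff_subset
  compl := fun W hW hcon => (mem_coreFam.1 hW).2 (mem_coreFam.1 hcon).1

/-- The avoiding members lie in the complement-free part of the shifted family. -/
theorem avoidFam_subset_coreFam {E' : Finset α} {e : α} (he : e ∉ E') {S : Finset (Finset α)}
    (h : IntersectingUpset (insert e E') S) : avoidFam e S ⊆ coreFam E' e S := by
  intro Z hZ
  have hZ' := (intersectingUpset_avoidFam he h).sub Z hZ
  rw [mem_avoidFam] at hZ
  rw [mem_coreFam, mem_shiftFam, mem_shiftFam]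
  refine ⟨⟨hZ.2, h.up Z hZ.1 _ (subset_insert e Z) (insert_subset_insert e hZ')⟩, ?_⟩
  rintro ⟨_, hcon⟩
  apply h.compl Z hZ.1
  have heq : insert e (E' \ Z) = insert e E' \ Z := by
    ext x
    simp only [mem_insert, mem_sdiff]
    constructor
    · rintro (rfl | ⟨hxE, hxZ⟩)
      · exact ⟨Or.inl rfl, hZ.2⟩
      · exact ⟨Or.inr hxE, hxZ⟩
    · rintro ⟨(rfl | hxE), hxZ⟩
      · exact Or.inl rfl
      · exact Or.inr ⟨hxE, hxZ⟩
  rw [← heq]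
  exact hcon

/-! ### The two sums -/

/-- The signed sum splits over the avoiding and the shifted members. -/
theorem sum_split (E' : Finset α) (e : α) (S : Finset (Finset α)) :
    ∑ Z ∈ S, (2 * (Z.card : ℤ) - (insert e E').card - 1) =
      ∑ Z ∈ avoidFam e S, (2 * (Z.card : ℤ) - (insert e E').card - 1) +
        ∑ W ∈ shiftFam e S, (2 * ((insert e W).card : ℤ) - (insert e E').card - 1) := by
  unfold avoidFam shiftFam
  rw [← sum_filter_add_sum_filter_not S (fun Z => e ∉ Z)]
  have hfil : S.filter (fun Z => ¬ e ∉ Z) = S.filter (fun Z => e ∈ Z) := by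
    apply filter_congr
    intro Z _
    exact not_not
  rw [hfil]
  congr 1
  rw [sum_image]
  · apply sum_congr rfl
    intro Z hZ
    rw [mem_filter] at hZ
    rw [insert_erase hZ.2]
  · intro Z₁ hZ₁ Z₂ hZ₂ heq
    rw [mem_coe, mem_filter] at hZ₁ hZ₂
    have heq' : Z₁.erase e = Z₂.erase e := heq
    rw [← insert_erase hZ₁.2, ← insert_erase hZ₂.2, heq']

/-- The complementary pairs of the shifted family cancel: the signed sum over `shiftFam` is the signed sum over its
complement-free part. -/
theorem sum_shiftFam_eq_sum_coreFam {E' : Finset α} {e : α} {S : Finset (Finset α)}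
    (h : IntersectingUpset (insert e E') S) :
    ∑ W ∈ shiftFam e S, (2 * (W.card : ℤ) - E'.card) = ∑ W ∈ coreFam E' e S, (2 * (W.card : ℤ) - E'.card) := by
  unfold coreFam
  rw [← sum_filter_add_sum_filter_not (shiftFam e S) (fun W => E' \ W ∉ shiftFam e S)]
  have hzero : ∑ W ∈ (shiftFam e S).filter (fun W => ¬ E' \ W ∉ shiftFam e S), (2 * (W.card : ℤ) - E'.card) = 0 := by
    apply sum_involution (fun W _ => E' \ W)
    · intro W hW
      rw [mem_filter] at hW
      have hWE : W ⊆ E' := subset_of_mem_shiftFam h hW.1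
      rw [card_sdiff_of_subset hWE, Nat.cast_sub (card_le_card hWE)]
      ring
    · intro W hW hne hcon
      apply hne
      have hWE : W ⊆ E' := subset_of_mem_shiftFam h (mem_filter.1 hW).1
      have hW0 : W = ∅ := by
        rw [← subset_empty]
        intro x hx
        have hx' : x ∈ E' \ W := by rw [hcon]; exact hx
        exact absurd hx (mem_sdiff.1 hx').2
      have hE0 : E' = ∅ := by
        rw [hW0, sdiff_empty] at hcon
        exact hcon
      rw [hW0, hE0]
      simp
    · intro W hW
      rw [mem_filter] at hW ⊢
      have hWE : W ⊆ E' := subset_of_mem_shiftFam h hW.1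
      refine ⟨not_not.1 hW.2, ?_⟩
      rw [Finset.sdiff_sdiff_eq_self hWE]
      exact not_not.2 hW.1
    · intro W hW
      exact Finset.sdiff_sdiff_eq_self (subset_of_mem_shiftFam h (mem_filter.1 hW).1)
  rw [hzero, add_zero]

/-! ### The theorem -/

/-- **THE FREE CASE OF (G)**: an intersecting up-set `S` of the power set of `E` satisfies
`Σ_{Z ∈ S} (2 #Z − #E − 1) ≥ 0`. -/
theorem sum_intersectingUpset_nonneg (E : Finset α) :
    ∀ S : Finset (Finset α), IntersectingUpset E S → 0 ≤ ∑ Z ∈ S, (2 * (Z.card : ℤ) - E.card - 1) := by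
  induction E using Finset.induction_on with
  | empty =>
    intro S hS
    have hS0 : S = ∅ := by
      rw [eq_empty_iff_forall_notMem]
      intro Z hZ
      have hZ0 : Z = ∅ := subset_empty.1 (hS.sub Z hZ)
      apply hS.compl Z hZ
      rw [hZ0, sdiff_empty]
      exact hZ0 ▸ hZ
    rw [hS0, sum_empty]
  | insert e E' he ih =>
    intro S hS
    have h0 := ih _ (intersectingUpset_avoidFam he hS)
    have h1 := ih _ (intersectingUpset_coreFam he hS)
    have hsub := card_le_card (avoidFam_subset_coreFam he hS)
    rw [sum_split E' e S]
    have hcardE : ((insert e E').card : ℤ) = E'.card + 1 := by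
      rw [card_insert_of_notMem he]
      push_cast
      ring
    have hA : ∑ Z ∈ avoidFam e S, (2 * (Z.card : ℤ) - (insert e E').card - 1) =
        ∑ Z ∈ avoidFam e S, ((2 * (Z.card : ℤ) - E'.card - 1) - 1) := by
      apply sum_congr rfl
      intro Z _
      rw [hcardE]
      ring
    have hB : ∑ W ∈ shiftFam e S, (2 * ((insert e W).card : ℤ) - (insert e E').card - 1) =
        ∑ W ∈ shiftFam e S, (2 * (W.card : ℤ) - E'.card) := by
      apply sum_congr rfl
      intro W hW
      have heW : e ∉ W := (mem_shiftFam.1 hW).1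
      rw [card_insert_of_notMem heW, hcardE]
      push_cast
      ring
    have hC : ∑ W ∈ coreFam E' e S, (2 * (W.card : ℤ) - E'.card) =
        ∑ W ∈ coreFam E' e S, ((2 * (W.card : ℤ) - E'.card - 1) + 1) := by
      apply sum_congr rfl
      intro W _
      ring
    rw [hA, hB, sum_shiftFam_eq_sum_coreFam hS, hC, sum_sub_distrib, sum_add_distrib, sum_const, sum_const,
      nsmul_eq_mul, nsmul_eq_mul, mul_one, mul_one]
    have hsub' : ((avoidFam e S).card : ℤ) ≤ (coreFam E' e S).card := by exact_mod_cast hsub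
    linarith

end PercRepro.Cogirth
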